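import Mathlib
import HarnessLib
import Summits.AtomisticToContinuum.Crystallization.Theorems.PricedLinkCensusSoftFourRingsRigRowsSound
import Summits.AtomisticToContinuum.Crystallization.Theorems.PricedLinkCensusSoftFourRingsRigCell

/-!
# Soft four-rings, metric half by certified numerics (7): soundness of the cell checker, I
Route `PricedLinkCensus`, sub-problem `Crystallization`, item `SoftFourRings`
(stmt-AtomisticToContinuum-14234).  For a well-formed model, a feasible configuration `x` in the
normal form of a cell (`InCell`) lies in the initial boxes (`initBoxes_sound`), and the three
box-transforming instructions preserve membership / cannot prune (`applyBound_sound`,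
`prune_sound`, `applyPlace_sound`).
-/

namespace Summit.AtomisticToContinuum.Crystallization.Theorems
namespace Rig
open Literature.Analysis.ValidatedNumerics.NumericsMP
open scoped Matrix
/-! ### Well-formed models, normal form -/

/-- Well-formedness of a model: symmetric bonds, a bonded frame triangle and free point, bonded
construction steps, distinct frame/free labels. -/
structure Model.WF (m : Model) : Prop where
  /-- symmetry -/
  symm : ∀ i j, m.bond i j = m.bond j i
  /-- frame bonds -/
  b01 : m.bond m.r0 m.r1 = true
  /-- frame bonds -/
  b02 : m.bond m.r0 m.r2 = true
  /-- frame bonds -/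
  b12 : m.bond m.r1 m.r2 = true
  /-- free point bonded to `r0` -/
  b0f : m.bond m.r0 m.free = true
  /-- steps are bonded to their parents -/
  steps : ∀ s ∈ m.steps, m.bond s.v s.a = true ∧ m.bond s.v s.b = true
  /-- steps have a new point -/
  stepsne : ∀ s ∈ m.steps, s.v ≠ s.a ∧ s.v ≠ s.b
  /-- distinct labels -/
  d01 : m.r0 ≠ m.r1
  /-- distinct labels -/
  d02 : m.r0 ≠ m.r2
  /-- distinct labels -/
  d12 : m.r1 ≠ m.r2
  /-- distinct labels -/
  df0 : m.free ≠ m.r0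
  /-- distinct labels -/
  df1 : m.free ≠ m.r1
  /-- distinct labels -/
  df2 : m.free ≠ m.r2

/-- **Normal form of a configuration in a cell**: `x r0 = e_z`; `x r1` in the `xz`-half-plane
`x ≥ 0`; `x r2` with `y ≥ 0`; the free point on the cell's chart with `y·S ∈ [tlo, thi]`. -/
def InCell (m : Model) (c : Cell) (x : Fin 12 → Fin 3 → ℝ) : Prop :=
  x m.r0 = ![0, 0, 1] ∧ x m.r1 1 = 0 ∧ 0 ≤ x m.r1 0 ∧ 0 ≤ x m.r2 1 ∧
  (c.tlo : ℝ) ≤ x m.free 1 * SC ∧ x m.free 1 * SC ≤ (c.thi : ℝ) ∧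
  (if c.xpos then 0 ≤ x m.free 0 else x m.free 0 ≤ 0)

/-- Bond window, symmetric form. -/
theorem bond_window {m : Model} (hW : m.WF) {x : Fin 12 → Fin 3 → ℝ} (hF : Feasible m.bond x)
    {i j : Fin 12} (hij : i ≠ j) (hb : m.bond i j = true) :
    cbloR ≤ x i ⬝ᵥ x j ∧ x i ⬝ᵥ x j ≤ chiR := by
  rcases lt_or_gt_of_ne hij with h | h
  · exact hF.2.1 i j h hb
  · rw [hW.symm] at hb
    rw [dotProduct_comm]
    exact hF.2.1 j i h hb

/-- Bond cosines are in `kappaI`. -/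
theorem mem_kappa_of_bond {m : Model} (hW : m.WF) {x : Fin 12 → Fin 3 → ℝ} (hF : Feasible m.bond x)
    {i j : Fin 12} (hij : i ≠ j) (hb : m.bond i j = true) : MI.mem SC (x i ⬝ᵥ x j) kappaI :=
  let h := bond_window hW hF hij hb
  mem_kappaI h.1 h.2

/-- `y ⬝ e_z = y 2`. -/
theorem dot_ez (y : Fin 3 → ℝ) : y ⬝ᵥ ![0, 0, 1] = y 2 := by
  rw [dotProduct, Fin.sum_univ_three]; simp
/-! ### The initial boxes -/

/-- Membership in a box from its three coordinates. -/
theorem IVec.mem_mk3 {p : Fin 3 → ℝ} {X Y Z : MI} (h0 : MI.mem SC (p 0) X) (h1 : MI.mem SC (p 1) Y)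
    (h2 : MI.mem SC (p 2) Z) : (IVec.mk X Y Z).mem p := by
  intro k; fin_cases k
  · exact h0
  · exact h1
  · exact h2

/-- `x r0 = e_z ∈ boxR0`. -/
theorem mem_boxR0 : boxR0.mem ![0, 0, (1 : ℝ)] := by
  intro k; fin_cases k
  · exact mem_zeroI
  · exact mem_zeroI
  · exact mem_oneI

/-- `x r1 ∈ boxR1`. -/
theorem mem_boxR1 {m : Model} (hW : m.WF) {x : Fin 12 → Fin 3 → ℝ} (hF : Feasible m.bond x)
    {c : Cell} (hc : InCell m c x) : boxR1.mem (x m.r1) := by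
  obtain ⟨h0, h1y, h1x, -⟩ := hc
  have hunit := hF.1 m.r1
  have hk : MI.mem SC (x m.r1 2) kappaI := by
    have := mem_kappa_of_bond hW hF hW.d01.symm (by rw [hW.symm]; exact hW.b01)
    rwa [h0, dot_ez] at this
  have hsq : x m.r1 0 = Real.sqrt (1 - x m.r1 2 * x m.r1 2) := by
    rw [dotProduct, Fin.sum_univ_three, h1y] at hunit
    have h : 1 - x m.r1 2 * x m.r1 2 = x m.r1 0 ^ 2 := by nlinarith
    rw [h, Real.sqrt_sq h1x]
  have hx0 : MI.mem SC (x m.r1 0) (sqrtI (oneI.sub (kappaI.mul SC kappaI))) := by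
    rw [hsq]
    refine mem_sqrtI (MI.mem_sub mem_oneI (MI.mem_mul SC_pos hk hk)) ?_
    rw [dotProduct, Fin.sum_univ_three, h1y] at hunit
    nlinarith
  have hx1 : MI.mem SC (x m.r1 1) zeroI := by rw [h1y]; exact mem_zeroI
  exact IVec.mem_mk3 hx0 hx1 hk

/-- Cross product with `e_z`: `e_z × b = (−b 1, b 0, 0)`. -/
theorem ez_cross (b : Fin 3 → ℝ) : ![0, 0, (1 : ℝ)] ⨯₃ b = ![-b 1, b 0, 0] := by
  rw [cross_apply]; simp

/-- `x r2` is on the `+` branch over the frame (because `y ≥ 0`). -/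
theorem r2_branch {m : Model} (hW : m.WF) {x : Fin 12 → Fin 3 → ℝ} (hF : Feasible m.bond x)
    {c : Cell} (hc : InCell m c x) {P M : IVec} (hpl : place boxR0 boxR1 kappaI kappaI = some (P, M)) :
    P.mem (x m.r2) := by
  have h0 := hc.1
  have h1y := hc.2.1
  have h1x := hc.2.2.1
  have h2y := hc.2.2.2.1
  have hA : boxR0.mem (x m.r0) := by rw [h0]; exact mem_boxR0
  have hB : boxR1.mem (x m.r1) := mem_boxR1 hW hF hc
  have ha : x m.r0 ⬝ᵥ x m.r0 = 1 := hF.1 _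
  have hb : x m.r1 ⬝ᵥ x m.r1 = 1 := hF.1 _
  have hv : x m.r2 ⬝ᵥ x m.r2 = 1 := hF.1 _
  have hka : MI.mem SC (x m.r2 ⬝ᵥ x m.r0) kappaI :=
    mem_kappa_of_bond hW hF hW.d02.symm (by rw [hW.symm]; exact hW.b02)
  have hkb : MI.mem SC (x m.r2 ⬝ᵥ x m.r1) kappaI :=
    mem_kappa_of_bond hW hF hW.d12.symm (by rw [hW.symm]; exact hW.b12)
  have hg1 := sq_lt_one_of_place hpl hA hB
  obtain ⟨hrad, hbr⟩ := place_branches ha hb hv rfl rfl hg1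
  have key : x m.r2 = brExpr true (x m.r0) (x m.r1) (x m.r2 ⬝ᵥ x m.r0) (x m.r2 ⬝ᵥ x m.r1) := by
    rcases hbr with hbr | hbr
    · exact hbr
    · -- the `−` branch has `y ≤ 0`; with `y ≥ 0` the `±` term vanishes
      set ρ := radR (x m.r0 ⬝ᵥ x m.r1) (x m.r2 ⬝ᵥ x m.r0) (x m.r2 ⬝ᵥ x m.r1)
      have hcross : x m.r0 ⨯₃ x m.r1 = ![-(x m.r1 1), x m.r1 0, 0] := by rw [h0, ez_cross]
      have h01 : x m.r0 1 = 0 := by rw [h0]; simp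
      have hc1 : (x m.r0 ⨯₃ x m.r1) 1 = x m.r1 0 := by rw [hcross]; simp
      have hy : x m.r2 1 = -Real.sqrt ρ * x m.r1 0 := by
        have := congrFun hbr 1
        simp only [brExpr, Pi.add_apply, Pi.smul_apply, smul_eq_mul, h01, h1y, hc1, mul_zero,
          add_zero, zero_add, Bool.false_eq_true, if_false] at this
        linarith [this]
      have hs0 : Real.sqrt ρ * x m.r1 0 = 0 := by
        have := Real.sqrt_nonneg ρ
        nlinarith [mul_nonneg this h1x]
      have hterm : Real.sqrt ρ • (x m.r0 ⨯₃ x m.r1) = 0 := by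
        rw [hcross, h1y]
        ext k; fin_cases k <;> simp [hs0]
      refine hbr.trans ?_
      unfold brExpr
      have e1 : ((if false = true then (1:ℝ) else -1) * Real.sqrt ρ) • (x m.r0 ⨯₃ x m.r1) = 0 := by
        rw [show ((if false = true then (1:ℝ) else -1) * Real.sqrt ρ) = -Real.sqrt ρ by simp, neg_smul,
          hterm, neg_zero]
      have e2 : ((if true = true then (1:ℝ) else -1) * Real.sqrt ρ) • (x m.r0 ⨯₃ x m.r1) = 0 := by
        rw [show ((if true = true then (1:ℝ) else -1) * Real.sqrt ρ) = Real.sqrt ρ by simp, hterm]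
      rw [e1, e2]
  simpa using mem_place_br hpl ha hb hv hA hB rfl rfl hka hkb key

/-- The free point lies in `boxFree` (and `boxFree` is not `none`). -/
theorem mem_boxFree {m : Model} (hW : m.WF) {x : Fin 12 → Fin 3 → ℝ} (hF : Feasible m.bond x)
    {c : Cell} (hc : InCell m c x) :
    ∃ F, boxFree c.xpos c.tlo c.thi = some F ∧ F.mem (x m.free) := by
  obtain ⟨h0, -, -, -, htlo, hthi, hch⟩ := hc
  have hunit := hF.1 m.free
  have hk : MI.mem SC (x m.free 2) kappaI := by
    have := mem_kappa_of_bond hW hF hW.df0 (by rw [hW.symm]; exact hW.b0f)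
    rwa [h0, dot_ez] at this
  have ht : MI.mem SC (x m.free 1) ⟨c.tlo, c.thi⟩ := ⟨htlo, hthi⟩
  set ρ := 1 - x m.free 2 * x m.free 2 - x m.free 1 * x m.free 1 with hρ
  have hρI : MI.mem SC ρ ((oneI.sub (kappaI.mul SC kappaI)).sub ((⟨c.tlo, c.thi⟩ : MI).mul SC ⟨c.tlo, c.thi⟩)) :=
    MI.mem_sub (MI.mem_sub mem_oneI (MI.mem_mul SC_pos hk hk)) (MI.mem_mul SC_pos ht ht)
  have hρx : ρ = x m.free 0 ^ 2 := by
    rw [dotProduct, Fin.sum_univ_three] at hunit; rw [hρ]; nlinarith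
  have hρ0 : 0 ≤ ρ := by rw [hρx]; positivity
  unfold boxFree
  simp only
  have hhi : ¬ ((oneI.sub (kappaI.mul SC kappaI)).sub ((⟨c.tlo, c.thi⟩ : MI).mul SC ⟨c.tlo, c.thi⟩)).hi < 0 := by
    intro hlt
    have := MI.neg_of_hi_neg hρI hlt
    linarith
  rw [if_neg hhi]
  refine ⟨_, rfl, ?_⟩
  have hsq := mem_sqrtI hρI hρ0
  have habs : Real.sqrt ρ = |x m.free 0| := by rw [hρx, Real.sqrt_sq_eq_abs]
  refine IVec.mem_mk3 ?_ ht hk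
  refine Rig.mem_clipUnit ?_ (Literature.Geometry.Riemannian.HamiltonODE.abs_apply_le_one_of_dot_self hunit 0)
  cases hxp : c.xpos with
  | true =>
    rw [hxp] at hch; simp only [if_true] at hch
    simp only [if_true]
    rw [habs, abs_of_nonneg hch] at hsq; exact hsq
  | false =>
    rw [hxp] at hch; simp only [Bool.false_eq_true, if_false] at hch
    simp only [Bool.false_eq_true, if_false]
    have := MI.mem_neg hsq
    rw [habs, abs_of_nonpos hch, neg_neg] at this; exact this

/-- **The initial boxes contain the configuration**: `initBoxes` never reports the cell as
vacuous, and if it starts the cell its boxes contain `x`. -/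
theorem initBoxes_sound {m : Model} (hW : m.WF) {x : Fin 12 → Fin 3 → ℝ} (hF : Feasible m.bond x)
    {c : Cell} (hc : InCell m c x) :
    initBoxes m c ≠ some none ∧ ∀ bx, initBoxes m c = some (some bx) → bx.mem x := by
  unfold initBoxes
  cases hpl : place boxR0 boxR1 kappaI kappaI with
  | none => simp
  | some PM =>
    obtain ⟨P, M⟩ := PM
    simp only
    obtain ⟨F, hF', hFm⟩ := mem_boxFree hW hF hc
    rw [hF']
    refine ⟨by simp, ?_⟩
    intro bx hbx
    simp only [Option.some.injEq] at hbx
    subst hbx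
    intro v B hvB
    simp only at hvB
    by_cases h1 : v = m.free
    · subst h1; rw [if_pos rfl] at hvB; cases hvB; exact hFm
    · rw [if_neg h1] at hvB
      by_cases h2 : v = m.r2
      · subst h2; rw [if_pos rfl] at hvB; cases hvB; exact r2_branch hW hF hc hpl
      · rw [if_neg h2] at hvB
        by_cases h3 : v = m.r1
        · subst h3; rw [if_pos rfl] at hvB; cases hvB; exact mem_boxR1 hW hF hc
        · rw [if_neg h3] at hvB
          by_cases h4 : v = m.r0
          · subst h4; rw [if_pos rfl] at hvB; cases hvB; rw [hc.1]; exact mem_boxR0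
          · rw [if_neg h4] at hvB; exact absurd hvB (by simp)
/-! ### The three box-transforming instructions -/

/-- The indicator objective sums to `± d v k`. -/
theorem sum_unitObj (v : Fin 12) (k : Fin 3) (up : Bool) (d : Fin 12 → Fin 3 → ℝ) :
    (∑ w, ∑ l, (unitObj v k up w l : ℝ) * d w l) = (if up then 1 else -1) * d v k := by
  unfold unitObj
  rw [Finset.sum_eq_single v, Finset.sum_eq_single k]
  · simp
  · intro l _ hl; simp [hl]
  · simp
  · intro w _ hw; simp [hw]
  · simp

/-- Membership in an updated family of boxes. -/
theorem mem_update {bx : Boxes} {x : Fin 12 → Fin 3 → ℝ} (hx : bx.mem x) (v : Fin 12) {B : IVec}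
    (hB : B.mem (x v)) : Boxes.mem (Function.update bx v (some B)) x := by
  intro w B' hw
  by_cases h : w = v
  · subst h; rw [Function.update_self] at hw; cases hw; exact hB
  · rw [Function.update_of_ne h] at hw; exact hx w B' hw

/-- **Soundness of `applyBound`**: it never prunes a cell containing `x`, and the new boxes
still contain `x`. -/
theorem applyBound_sound {m : Model} {x : Fin 12 → Fin 3 → ℝ} (hF : Feasible m.bond x)
    {bx : Boxes} (hx : bx.mem x) (st : List Step) (v : Fin 12) (k : Fin 3) (up : Bool) (cert : Cert) :
    applyBound m bx st v k up cert ≠ Outcome.pruned ∧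
    ∀ bx' st', applyBound m bx st v k up cert = Outcome.running bx' st' → bx'.mem x ∧ st' = st := by
  have hS : (0 : ℝ) < SC := by exact_mod_cast SC_pos
  unfold applyBound
  cases hv : bx v with
  | none => simp
  | some B =>
    simp only
    have hrows : ∀ r ∈ (rowsOf m.bond bx).toArray, r.Holds (bx.disp x) := by
      intro r hr; exact rows_hold hF hx r (List.mem_toArray.1 hr)
    have hd := Boxes.dispIn_of_mem hx
    have hU := certUpper_sound hrows hd (unitObj v k up) cert
    rw [sum_unitObj] at hU
    set U := certUpper bx (rowsOf m.bond bx).toArray (unitObj v k up) cert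
    have hplaced : bx.placed v = true := by simp [Boxes.placed, hv]
    have hdisp : bx.disp x v k = x v k - bx.c v k := by simp [Boxes.disp, hplaced]
    have hxk := hx v B hv k
    rw [← Boxes.ivl_of_some hv k] at hxk
    obtain ⟨hlo, hhi⟩ := hxk
    have hwin : (if up then x v k * SC ≤ (bx.C v k : ℝ) + U else (bx.C v k : ℝ) - U ≤ x v k * SC) := by
      unfold Boxes.c at hdisp
      cases up with
      | true =>
        simp only [if_true, one_mul] at hU ⊢
        rw [hdisp, le_div_iff₀ hS] at hU
        have : (x v k - (bx.C v k : ℝ) / SC) * SC = x v k * SC - bx.C v k := by field_simp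
        linarith [hU, this]
      | false =>
        simp only [Bool.false_eq_true, if_false, neg_one_mul] at hU ⊢
        rw [hdisp, le_div_iff₀ hS] at hU
        have : -(x v k - (bx.C v k : ℝ) / SC) * SC = -(x v k * SC) + bx.C v k := by
          field_simp; ring
        linarith [hU, this]
    set I' : MI := if up then ⟨(B.get k).lo, min (B.get k).hi (bx.C v k + U)⟩
      else ⟨max (B.get k).lo (bx.C v k - U), (B.get k).hi⟩ with hI'
    have hmemI' : MI.mem SC (x v k) I' := by
      rw [Boxes.ivl_of_some hv k] at hlo hhi
      cases up with
      | true =>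
        simp only [if_true] at hwin hI'
        rw [hI']
        refine ⟨hlo, ?_⟩
        push_cast
        exact le_min hhi hwin
      | false =>
        simp only [Bool.false_eq_true, if_false] at hwin hI'
        rw [hI']
        refine ⟨?_, hhi⟩
        push_cast
        exact max_le hlo hwin
    constructor
    · intro hpr
      by_cases hlt : I'.hi < I'.lo
      · have h1 := hmemI'.1; have h2 := hmemI'.2
        have : (I'.hi : ℝ) < I'.lo := by exact_mod_cast hlt
        linarith
      · rw [if_neg hlt] at hpr; exact absurd hpr (by simp)
    · intro bx' st' hrun
      by_cases hlt : I'.hi < I'.lo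
      · rw [if_pos hlt] at hrun; exact absurd hrun (by simp)
      · rw [if_neg hlt] at hrun
        simp only [Outcome.running.injEq] at hrun
        obtain ⟨rfl, rfl⟩ := hrun
        refine ⟨mem_update hx v ?_, rfl⟩
        intro l
        simp only [IVec.setCoord, IVec.get_ofFn]
        by_cases hl : l = k
        · subst hl; rw [if_pos rfl]; exact hmemI'
        · rw [if_neg hl]; exact hx v B hv l

/-- **Soundness of `prune`**: a cell containing `x` is never pruned. -/
theorem prune_sound {m : Model} {x : Fin 12 → Fin 3 → ℝ} (hF : Feasible m.bond x) {bx : Boxes}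
    (hx : bx.mem x) (terms : List (ℕ × ℕ)) :
    certInfeasible bx (rowsOf m.bond bx).toArray terms = false := by
  by_contra h
  rw [Bool.not_eq_false] at h
  exact certInfeasible_sound (fun r hr => rows_hold hF hx r (List.mem_toArray.1 hr))
    (Boxes.dispIn_of_mem hx) h

/-- The step invariant: remaining steps are bonded to (and distinct from) their parents. -/
def StepsOK (m : Model) (st : List Step) : Prop :=
  ∀ s ∈ st, (m.bond s.v s.a = true ∧ m.bond s.v s.b = true) ∧ (s.v ≠ s.a ∧ s.v ≠ s.b)

/-- The model's own step list satisfies the invariant. -/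
theorem stepsOK_of_WF {m : Model} (hW : m.WF) : StepsOK m m.steps :=
  fun s hs => ⟨hW.steps s hs, hW.stepsne s hs⟩

/-- **Soundness of `placeBoxes`**: the new point lies in the main or in the alternative box, and
the step invariant passes to the remaining steps. -/
theorem placeBoxes_sound {m : Model} (hW : m.WF) {x : Fin 12 → Fin 3 → ℝ} (hF : Feasible m.bond x)
    {bx : Boxes} (hx : bx.mem x) {st : List Step} (hst : StepsOK m st)
    {v : Fin 12} {main alt : IVec} {rest : List Step}
    (h : placeBoxes bx st = some (v, main, alt, rest)) :
    (main.mem (x v) ∨ alt.mem (x v)) ∧ StepsOK m rest := by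
  unfold placeBoxes at h
  cases st with
  | nil => exact absurd h (by simp)
  | cons s rest' =>
    simp only at h
    obtain ⟨⟨hva, hvb⟩, hnea, hneb⟩ := hst s (by simp)
    have hrest : StepsOK m rest' := fun s' hs' => hst s' (by simp [hs'])
    cases hA : bx s.a with
    | none => rw [hA] at h; exact absurd h (by simp)
    | some A =>
      cases hB : bx s.b with
      | none => rw [hA, hB] at h; exact absurd h (by simp)
      | some B =>
        rw [hA, hB] at h
        simp only at h
        cases hpl : place A B kappaI kappaI with
        | none => rw [hpl] at h; exact absurd h (by simp)
        | some PM =>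
          obtain ⟨P, M⟩ := PM
          rw [hpl] at h
          simp only [Option.some.injEq, Prod.mk.injEq] at h
          obtain ⟨rfl, rfl, rfl, rfl⟩ := h
          refine ⟨?_, hrest⟩
          have hAm : A.mem (x s.a) := hx _ _ hA
          have hBm : B.mem (x s.b) := hx _ _ hB
          have ha : x s.a ⬝ᵥ x s.a = 1 := hF.1 _
          have hb : x s.b ⬝ᵥ x s.b = 1 := hF.1 _
          have hv : x s.v ⬝ᵥ x s.v = 1 := hF.1 _
          have hka : MI.mem SC (x s.v ⬝ᵥ x s.a) kappaI := mem_kappa_of_bond hW hF hnea hva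
          have hkb : MI.mem SC (x s.v ⬝ᵥ x s.b) kappaI := mem_kappa_of_bond hW hF hneb hvb
          have hg1 := sq_lt_one_of_place hpl hAm hBm
          obtain ⟨-, hbr⟩ := place_branches ha hb hv (rfl : x s.v ⬝ᵥ x s.a = _) rfl hg1
          rcases hbr with hbr | hbr
          · have h1 := mem_place_br hpl ha hb hv hAm hBm rfl rfl hka hkb hbr
            cases hsg : s.sign
            · right; simpa [hsg] using h1
            · left; simpa [hsg] using h1
          · have h1 := mem_place_br hpl ha hb hv hAm hBm rfl rfl hka hkb hbr
            cases hsg : s.sign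
            · left; simpa [hsg] using h1
            · right; simpa [hsg] using h1

end Rig

end Summit.AtomisticToContinuum.Crystallization.Theorems
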